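import Literature.FieldTheory.AlgClosed.AutFixedSubfield
import Literature.AlgebraicGeometry.Motives.ZarhinHodgeGroupAutC
import Mathlib.NumberTheory.NumberField.InfinitePlace.Embeddings
import Mathlib.FieldTheory.PrimitiveElement
import Mathlib.Data.Fintype.CardEmbedding
import HarnessLib

/-!
# MULTI-FIELD WEIL ENGINE — ORBIT COUNTING FOR `Aut(ℂ/M)`: transitivity of the automorphisms of `ℂ` fixing a number field
# `M ⊂ ℂ` on families of complex embeddings of number fields, from the DEGREE OF ONE COMPOSITUM

Cell `pub-hodgecm2` (COR-CM), seat b30 gen 31 (2026-08-24); count-neutral own lane MULTI-FIELD WEIL ENGINE (stem `MultiFieldWeil*`).  Pure field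
theory (theorems only; no definition, no named fact, no `sorry`); nothing Hodge-theoretic is asserted and `HC_CM` is NOT proved.  Companion of
`CorCM/MultiFieldWeilJointEmbeddings.lean` (T8: joint transitivity of `Aut(ℂ)` on PAIRS of embeddings from `K₀ ⊗_k K₁` a field) and the source of
the Galois ∕ degree forms of the hypotheses `hH` (`CorCM/MultiFieldWeilEqualPrimes.lean`), `hJ` (`CorCM/MultiFieldWeilJointPrimesHodge.lean`) and `h2T`
(`CorCM/MultiFieldWeilTwoTransitiveTower.lean`) of the engine's headlines (sequel `CorCM/MultiFieldWeilGaloisHypotheses.lean`).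

THE PRINCIPLE (Galois correspondence for the huge group `Aut(ℂ)`, run by COUNTING).  Let `M ⊂ ℂ` be a subfield of finite degree over `ℚ` and let
`s = (s_j)_{j ∈ J}` be a finite family of complex embeddings of number fields `K_j`, each restricting to a fixed embedding `τ` of a common subfield `k`
(`s_j ∘ i_j = τ`, `τ(k) ⊆ M`).  Put `F = M(s_j(K_j) : j)`, a number field.  Every `M`-embedding `φ : F → ℂ` gives a new admissible family `(φ ∘ s_j)_j`,
distinct `φ` give distinct families (`F` is generated by the `s_j(K_j)` over `M`), there are exactly `[F : M]` such `φ` (Dedekind–Artin, Mathlib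
`AlgHom.card`), and every one of them is the restriction of an automorphism of `ℂ` fixing `M` (the countable field `F` has two embeddings
`F ⊂ ℂ` and `φ`; the tree's `ZarhinLie.exists_ringEquiv_complex_comp_eq`).  Hence:

* §2 **`exists_ringEquiv_fix_comp_eq_of_finrank`** — if `[F : M]` equals the NUMBER of admissible families, `∏_j n_j` (`n_j` = the number of
  embeddings of `K_j` over `τ`, i.e. `[K_j : k]`), then `Aut(ℂ/M)` carries `s` to EVERY admissible family; **`exists_ringEquiv_fix_comp_eq_comp_of_finrank`**
  — hence any admissible family to any other (JOINT TRANSITIVITY relative to `M`; with `M = ℚ(τk)` this is the hypothesis `hJ` of the joint prime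
  tower, for ANY number of fields — the `r`-fold form of T8's tensor criterion, since `[F : τk] = ∏ [K_j : k]` says precisely that
  `⨂_k K_j → F` is an isomorphism).  The degree hypothesis is stated on the `ℚ`-subfield `M ⊔ ℚ(⋃_j s_j(K_j))` of `ℂ`
  (Mathlib `IntermediateField.restrictScalars_adjoin_eq_sup`), so that it is a statement about ONE explicit number field.
* §3 **`exists_ringEquiv_fix_comp_eq_of_injective_of_finrank`** — ONE field `K ⊇ i(k)` and an INJECTIVE family `(s_j)_{j ∈ J}` of embeddings over `τ`:
  if `[M(s_j(K) : j) : M] = n (n−1) ⋯ (n−|J|+1)` (`Fintype.card_embedding_eq`), then `Aut(ℂ/M)` is `|J|`-TRANSITIVE on the embeddings of `K` over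
  `τ`; **`exists_ringEquiv_fix_pair_of_finrank`** — the case `|J| = 2`: `[M·s(K)·t(K) : M] = n(n−1)` for ONE pair `s ≠ t` gives the relative
  `2`-transitivity `h2T` of the `2`-transitive ∕ mixed towers.
* §1 **`exists_ringEquiv_fix_comp_ne_of_apply_not_mem`** — the degenerate "move" form behind `hH`: an embedding `s₀` taking some value OUTSIDE `M`
  is moved by an automorphism of `ℂ` fixing `M` pointwise (the tree's `Complex.exists_ringEquiv_fix_apply_ne`: the fixed field of `Aut(ℂ/M)` is `M`);
  §1b `adjoin_range_ringHom_eq_fieldRange`, `finrank_adjoin_range_ringHom` (`ℚ(τ(k))` is the image of `τ`, of degree `[k : ℚ]`).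

[cite: Lang2002, VI §1 Thm. 1.1, Cor. 1.6 and V §2 Thm. 2.8] [cite: Shimura1998, §18.2 Lemma (i)] [cite: DixonMortimer1996, §1.6]

## References
* [Lang2002] S. Lang, *Algebra*, 3rd ed., GTM 211: V §2 Thm. 2.8 (extension of embeddings into algebraically closed fields), VI §1 Thm. 1.1 and
  Cor. 1.6 (Galois correspondence; `|Hom_M(F, M̄)| = [F : M]`).
* [Shimura1998] G. Shimura, *Abelian varieties with complex multiplication and modular functions*, §18.2 Lemma (i).
* [DixonMortimer1996] J. D. Dixon, B. Mortimer, *Permutation Groups*, GTM 163, §1.6 (`k`-transitivity; the number of ordered `k`-tuples).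
-/

noncomputable section

open IntermediateField
open scoped Cardinal Classical

namespace Summit.HodgeConjecture.CorCM.MultiFieldWeil

open Literature.FieldTheory.AlgClosed

/-! ## §1 Moving an embedding that leaves `M` -/

section Move

variable (M : IntermediateField ℚ ℂ) [FiniteDimensional ℚ M]

/-- A subfield of `ℂ` of finite degree over `ℚ` is countable. [folklore] -/
theorem countable_of_finiteDimensional_intermediateField : Countable M :=
  Countable.of_equiv _ (Module.finBasis ℚ M).equivFun.toEquiv.symm

/-- **An embedding taking a value outside `M` is moved by `Aut(ℂ/M)`.**  If `s₀ : K → ℂ` is a ring homomorphism and `s₀ a ∉ M` for some `a`,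
where `M ⊂ ℂ` has finite degree over `ℚ`, then some automorphism `ρ` of `ℂ` fixes `M` pointwise and `ρ ∘ s₀ ≠ s₀` (the fixed field of
`Aut(ℂ/M)` is `M`: the tree's `Complex.exists_ringEquiv_fix_apply_ne`). [cite: Lang2002, VI §1 Thm. 1.1, Cor. 1.6 and V §2 Thm. 2.8] -/
theorem exists_ringEquiv_fix_comp_ne_of_apply_not_mem {K : Type*} [NonAssocSemiring K] (s₀ : K →+* ℂ) {a : K} (ha : s₀ a ∉ M) :
    ∃ ρ : ℂ ≃+* ℂ, (∀ x ∈ M, ρ x = x) ∧ (ρ : ℂ →+* ℂ).comp s₀ ≠ s₀ := by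
  haveI : Countable M := countable_of_finiteDimensional_intermediateField M
  haveI : Countable M.toSubfield := Countable.of_equiv M (Equiv.refl _)
  have hM : #M.toSubfield ≤ ℵ₀ := Cardinal.mk_le_aleph0
  obtain ⟨ρ, hfix, hne⟩ := Complex.exists_ringEquiv_fix_apply_ne M.toSubfield hM (z := s₀ a) ha
  exact ⟨ρ, fun x hx => hfix x hx, fun h => hne (RingHom.congr_fun h a)⟩

end Move

/-! ## §1b The subfield generated by one embedding -/

section Range

variable {K : Type} [Field K] [NumberField K]

/-- The subfield of `ℂ` generated by the image of an embedding `τ` of a number field is that image. [folklore] -/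
theorem adjoin_range_ringHom_eq_fieldRange (τ : K →+* ℂ) : adjoin ℚ (Set.range τ) = τ.toRatAlgHom.fieldRange := by
  refine le_antisymm (adjoin_le_iff.2 ?_) fun x hx => ?_
  · rintro x ⟨y, rfl⟩
    exact ⟨y, rfl⟩
  · obtain ⟨y, rfl⟩ := AlgHom.mem_fieldRange.1 hx
    exact subset_adjoin ℚ _ ⟨y, rfl⟩

/-- `ℚ(τ(k)) ⊂ ℂ` has degree `[k : ℚ]`: the subfield of `ℂ` generated by the image of an embedding `τ` of a number field `k` is that image.
[folklore] -/
theorem finrank_adjoin_range_ringHom (τ : K →+* ℂ) : Module.finrank ℚ ↥(adjoin ℚ (Set.range τ)) = Module.finrank ℚ K := by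
  rw [adjoin_range_ringHom_eq_fieldRange]
  exact (LinearEquiv.finrank_eq (AlgEquiv.ofInjectiveField τ.toRatAlgHom).toLinearEquiv).symm

end Range

/-! ## §2 Families of embeddings of several fields: transitivity of `Aut(ℂ/M)` from the degree of one compositum -/

section Family

variable {J : Type} [Fintype J] {K : J → Type} [∀ j, Field (K j)] [∀ j, NumberField (K j)] {k : Type} [Field k]
  (i : ∀ j, k →+* K j) (τ : k →+* ℂ)

/-- **The number of admissible families** `(u_j)_j`, `u_j : K_j → ℂ` over `τ` (`u_j ∘ i_j = τ`), is `∏_j n_j`, `n_j` the number of embeddings of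
`K_j` over `τ`. [cite: DixonMortimer1996, §1.6] -/
theorem card_families_over (n : J → ℕ) (hn : ∀ j, (Finset.univ.filter fun u : K j →+* ℂ => u.comp (i j) = τ).card = n j) :
    Fintype.card {u : ∀ j, K j →+* ℂ // ∀ j, (u j).comp (i j) = τ} = ∏ j, n j := by
  classical
  rw [Fintype.card_congr (Equiv.subtypePiEquivPi (p := fun j (v : K j →+* ℂ) => v.comp (i j) = τ)), Fintype.card_pi]
  refine Finset.prod_congr rfl fun j _ => ?_
  rw [Fintype.card_subtype, hn j]

/-- **Two `M`-algebra maps out of `M(S)` that agree on `S` are equal.** [folklore] -/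
theorem algHom_adjoin_ext (M : IntermediateField ℚ ℂ) {S : Set ℂ} {φ ψ : ↥(adjoin M S) →ₐ[M] ℂ}
    (h : ∀ (x : ℂ) (hx : x ∈ S), φ ⟨x, subset_adjoin M S hx⟩ = ψ ⟨x, subset_adjoin M S hx⟩) : φ = ψ := by
  apply AlgHom.ext
  rintro ⟨x, hx⟩
  induction hx using adjoin_induction with
  | mem x hx => exact h x hx
  | algebraMap x => exact (φ.commutes x).trans (ψ.commutes x).symm
  | add x y hx hy ihx ihy =>
    have e : (⟨x + y, add_mem hx hy⟩ : ↥(adjoin M S)) = ⟨x, hx⟩ + ⟨y, hy⟩ := rfl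
    rw [e, map_add, map_add, ihx, ihy]
  | inv x hx ihx =>
    have e : (⟨x⁻¹, inv_mem hx⟩ : ↥(adjoin M S)) = (⟨x, hx⟩ : ↥(adjoin M S))⁻¹ := rfl
    rw [e, map_inv₀, map_inv₀, ihx]
  | mul x y hx hy ihx ihy =>
    have e : (⟨x * y, mul_mem hx hy⟩ : ↥(adjoin M S)) = ⟨x, hx⟩ * ⟨y, hy⟩ := rfl
    rw [e, map_mul, map_mul, ihx, ihy]

/-- **Every `M`-embedding of a subfield `M(S) ⊂ ℂ` of finite degree is the restriction of an automorphism of `ℂ` fixing `M` pointwise**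
(extension from the countable field `M(S)`; the tree's `ZarhinLie.exists_ringEquiv_complex_comp_eq`). [cite: Lang2002, V §2 Thm. 2.8] -/
theorem exists_ringEquiv_extends_algHom_adjoin (M : IntermediateField ℚ ℂ) {S : Set ℂ} [FiniteDimensional ℚ ↥(adjoin M S)]
    (φ : ↥(adjoin M S) →ₐ[M] ℂ) :
    ∃ ρ : ℂ ≃+* ℂ, (∀ x ∈ M, ρ x = x) ∧ ∀ (x : ℂ) (hx : x ∈ adjoin M S), ρ x = φ ⟨x, hx⟩ := by
  haveI : Countable ↥(adjoin M S) := Countable.of_equiv _ (Module.finBasis ℚ ↥(adjoin M S)).equivFun.toEquiv.symm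
  obtain ⟨ρ, hρ⟩ := Literature.AlgebraicGeometry.Motives.ZarhinLie.exists_ringEquiv_complex_comp_eq
    (algebraMap ↥(adjoin M S) ℂ) φ.toRingHom
  refine ⟨ρ, fun x hx => ?_, fun x hx => hρ ⟨x, hx⟩⟩
  have h := hρ (algebraMap M ↥(adjoin M S) ⟨x, hx⟩)
  rw [AlgHom.toRingHom_eq_coe, RingHom.coe_coe, AlgHom.commutes] at h
  exact h

variable {i τ} in
/-- **ORBIT COUNTING: `Aut(ℂ/M)` reaches every admissible family when ONE compositum has degree `∏_j n_j` over `M`.**  `M ⊂ ℂ` of finite degree over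
`ℚ` containing `τ(k)`; `s = (s_j)_j` a family of embeddings `K_j → ℂ` over `τ`; `n_j` the number of embeddings of `K_j` over `τ`.  If the subfield
`M ⊔ ℚ(⋃_j s_j(K_j))` of `ℂ` has degree `[M : ℚ] · ∏_j n_j` over `ℚ` — i.e. `[M(s_j(K_j) : j) : M] = ∏_j n_j`, the number of admissible families —
then for EVERY family `s'` over `τ` some automorphism `ρ` of `ℂ` fixes `M` pointwise and has `ρ ∘ s_j = s'_j` for all `j`.  Proof: the `[F : M]`
`M`-embeddings `φ` of `F = M(s_j(K_j) : j)` (Mathlib `AlgHom.card`) give pairwise distinct admissible families `(φ ∘ s_j)_j`, hence all of them, and each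
`φ` extends to `ℂ`. [cite: Lang2002, VI §1 Thm. 1.1, Cor. 1.6 and V §2 Thm. 2.8] [cite: Shimura1998, §18.2 Lemma (i)] -/
theorem exists_ringEquiv_fix_comp_eq_of_finrank (M : IntermediateField ℚ ℂ) [FiniteDimensional ℚ M] (hτM : ∀ x, τ x ∈ M)
    (s : ∀ j, K j →+* ℂ) (hs : ∀ j, (s j).comp (i j) = τ) (n : J → ℕ)
    (hn : ∀ j, (Finset.univ.filter fun u : K j →+* ℂ => u.comp (i j) = τ).card = n j)
    (hdeg : Module.finrank ℚ ↥(M ⊔ adjoin ℚ (⋃ j, Set.range (s j))) = Module.finrank ℚ M * ∏ j, n j)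
    (s' : ∀ j, K j →+* ℂ) (hs' : ∀ j, (s' j).comp (i j) = τ) :
    ∃ ρ : ℂ ≃+* ℂ, (∀ x ∈ M, ρ x = x) ∧ ∀ j, (ρ : ℂ →+* ℂ).comp (s j) = s' j := by
  classical
  set S : Set ℂ := ⋃ j, Set.range (s j) with hS
  -- the compositum `F = M(S)` as an extension of `M`; it has finite degree
  have hpos : 0 < Module.finrank ℚ M * ∏ j, n j := by
    refine Nat.mul_pos Module.finrank_pos (Finset.prod_pos fun j _ => ?_)
    rw [← hn j]
    exact Finset.card_pos.2 ⟨s j, Finset.mem_filter.2 ⟨Finset.mem_univ _, hs j⟩⟩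
  have hres : (adjoin M S).restrictScalars ℚ = M ⊔ adjoin ℚ S := restrictScalars_adjoin_eq_sup ℚ M S
  have hdegQ : Module.finrank ℚ ↥((adjoin M S).restrictScalars ℚ) = Module.finrank ℚ M * ∏ j, n j := by
    rw [hres, hdeg]
  haveI hfinQ : FiniteDimensional ℚ ↥(adjoin M S) := by
    have h : FiniteDimensional ℚ ↥((adjoin M S).restrictScalars ℚ) := Module.finite_of_finrank_pos (by rw [hdegQ]; exact hpos)
    exact h
  haveI : FiniteDimensional M ↥(adjoin M S) := Module.Finite.of_restrictScalars_finite ℚ M _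
  have hdegM : Module.finrank M ↥(adjoin M S) = ∏ j, n j := by
    have h := Module.finrank_mul_finrank ℚ M ↥(adjoin M S)
    have h' : Module.finrank ℚ ↥(adjoin M S) = Module.finrank ℚ M * ∏ j, n j := hdegQ
    rw [h'] at h
    exact Nat.eq_of_mul_eq_mul_left Module.finrank_pos h
  -- the generators lie in `F`
  have hmemF : ∀ j (a : K j), s j a ∈ adjoin M S := fun j a => subset_adjoin M S (Set.mem_iUnion.2 ⟨j, a, rfl⟩)
  -- restriction of an `M`-embedding of `F` to the family
  let Φ : (↥(adjoin M S) →ₐ[M] ℂ) → {u : ∀ j, K j →+* ℂ // ∀ j, (u j).comp (i j) = τ} := fun φ =>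
    ⟨fun j => φ.toRingHom.comp ((s j).codRestrict (adjoin M S) (hmemF j)), fun j => by
      ext x
      have h1 : s j (i j x) = τ x := RingHom.congr_fun (hs j) x
      have h2 : (⟨s j (i j x), hmemF j _⟩ : ↥(adjoin M S)) = algebraMap M ↥(adjoin M S) ⟨τ x, hτM x⟩ := Subtype.ext h1
      show φ ⟨s j (i j x), hmemF j _⟩ = τ x
      rw [h2, AlgHom.commutes]
      rfl⟩
  have hΦapp : ∀ φ j (a : K j), ((Φ φ).1 j) a = φ ⟨s j a, hmemF j a⟩ := fun φ j a => rfl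
  -- `Φ` is injective: `F` is generated by the `s_j(K_j)` over `M`
  have hΦ : Function.Injective Φ := by
    intro φ ψ h
    apply algHom_adjoin_ext M
    intro x hx
    obtain ⟨j, a, rfl⟩ := Set.mem_iUnion.1 hx
    rw [← hΦapp φ j a, ← hΦapp ψ j a, h]
  -- counting: `Φ` is a bijection
  have hcard : Fintype.card (↥(adjoin M S) →ₐ[M] ℂ) = Fintype.card {u : ∀ j, K j →+* ℂ // ∀ j, (u j).comp (i j) = τ} := by
    rw [AlgHom.card M ↥(adjoin M S) ℂ, hdegM, card_families_over i τ n hn]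
  obtain ⟨φ, hφ⟩ := ((Fintype.bijective_iff_injective_and_card Φ).2 ⟨hΦ, hcard⟩).2 ⟨s', hs'⟩
  -- extend `φ` to `ℂ`
  obtain ⟨ρ, hρM, hρ⟩ := exists_ringEquiv_extends_algHom_adjoin M φ
  refine ⟨ρ, hρM, fun j => RingHom.ext fun a => ?_⟩
  rw [RingHom.coe_comp, Function.comp_apply, RingHom.coe_coe, hρ (s j a) (hmemF j a), ← hΦapp φ j a, hφ]

variable {i τ} in
/-- **JOINT TRANSITIVITY of `Aut(ℂ/M)` on the admissible families**, from the degree of ONE compositum: under the hypotheses of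
`exists_ringEquiv_fix_comp_eq_of_finrank`, any family over `τ` is carried to any other by an automorphism of `ℂ` fixing `M` pointwise.  With
`M = ℚ(τk)` this is the hypothesis `hJ` of `hodgeConjectureFor_biproduct_comp_of_sextics` ∕ `…_of_jointPrimeTower_oneMember`, for ANY number of
fields. [cite: Lang2002, VI §1 Thm. 1.1, Cor. 1.6 and V §2 Thm. 2.8] [cite: Shimura1998, §18.2 Lemma (i)] -/
theorem exists_ringEquiv_fix_comp_eq_comp_of_finrank (M : IntermediateField ℚ ℂ) [FiniteDimensional ℚ M] (hτM : ∀ x, τ x ∈ M)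
    (s : ∀ j, K j →+* ℂ) (hs : ∀ j, (s j).comp (i j) = τ) (n : J → ℕ)
    (hn : ∀ j, (Finset.univ.filter fun u : K j →+* ℂ => u.comp (i j) = τ).card = n j)
    (hdeg : Module.finrank ℚ ↥(M ⊔ adjoin ℚ (⋃ j, Set.range (s j))) = Module.finrank ℚ M * ∏ j, n j)
    (s' s'' : ∀ j, K j →+* ℂ) (hs' : ∀ j, (s' j).comp (i j) = τ) (hs'' : ∀ j, (s'' j).comp (i j) = τ) :
    ∃ ρ : ℂ ≃+* ℂ, (∀ x ∈ M, ρ x = x) ∧ ∀ j, (ρ : ℂ →+* ℂ).comp (s' j) = s'' j := by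
  obtain ⟨ρ', hρ'M, hρ'⟩ := exists_ringEquiv_fix_comp_eq_of_finrank M hτM s hs n hn hdeg s' hs'
  obtain ⟨ρ'', hρ''M, hρ''⟩ := exists_ringEquiv_fix_comp_eq_of_finrank M hτM s hs n hn hdeg s'' hs''
  refine ⟨ρ'.symm.trans ρ'', fun x hx => ?_, fun j => ?_⟩
  · have h1 : ρ'.symm x = x := by
      rw [RingEquiv.symm_apply_eq]
      exact (hρ'M x hx).symm
    show ρ'' (ρ'.symm x) = x
    rw [h1, hρ''M x hx]
  · ext a
    have h1 : ρ'.symm (s' j a) = s j a := by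
      rw [RingEquiv.symm_apply_eq]
      exact (RingHom.congr_fun (hρ' j) a).symm
    show ρ'' (ρ'.symm (s' j a)) = s'' j a
    rw [h1]
    exact RingHom.congr_fun (hρ'' j) a

end Family

/-! ## §3 Injective families of embeddings of ONE field: `|J|`-transitivity of `Aut(ℂ/M)` from the degree `n(n−1)⋯(n−|J|+1)` -/

section Injective

variable {J : Type} [Fintype J] {K : Type} [Field K] [NumberField K] {k : Type} [Field k] (i : k →+* K) (τ : k →+* ℂ)

/-- **The number of INJECTIVE families `J ↪ {embeddings of K over τ}` is the descending factorial `n (n−1) ⋯ (n−|J|+1)`**, `n` the number of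
embeddings of `K` over `τ`. [cite: DixonMortimer1996, §1.6] -/
theorem card_injective_families_over (n : ℕ) (hn : (Finset.univ.filter fun u : K →+* ℂ => u.comp i = τ).card = n) :
    Fintype.card {u : J → (K →+* ℂ) // Function.Injective u ∧ ∀ j, (u j).comp i = τ} = n.descFactorial (Fintype.card J) := by
  classical
  let e : {u : J → (K →+* ℂ) // Function.Injective u ∧ ∀ j, (u j).comp i = τ} ≃ (J ↪ {v : K →+* ℂ // v.comp i = τ}) :=
    { toFun := fun u => ⟨fun j => ⟨u.1 j, u.2.2 j⟩, fun j j' h => u.2.1 (congrArg Subtype.val h)⟩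
      invFun := fun f => ⟨fun j => (f j).1, fun j j' h => f.injective (Subtype.ext h), fun j => (f j).2⟩
      left_inv := fun u => rfl
      right_inv := fun f => rfl }
  rw [Fintype.card_congr e, Fintype.card_embedding_eq, Fintype.card_subtype, hn]

variable {i τ} in
/-- **ORBIT COUNTING FOR INJECTIVE FAMILIES: `Aut(ℂ/M)` is `|J|`-TRANSITIVE on the embeddings of `K` over `τ` when ONE compositum has degree
`n (n−1) ⋯ (n−|J|+1)` over `M`.**  `M ⊂ ℂ` of finite degree containing `τ(k)`; `s : J → Hom(K, ℂ)` injective with every `s_j` over `τ`; if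
`[M ⊔ ℚ(⋃_j s_j(K)) : ℚ] = [M : ℚ] · n(n−1)⋯(n−|J|+1)` then every injective family `s'` over `τ` is `(ρ ∘ s_j)_j` for an automorphism `ρ` of `ℂ`
fixing `M` pointwise (the `M`-embeddings of `F = M(s_j(K) : j)` give pairwise distinct injective families; there are `[F : M]` of them; each extends to
`ℂ`). [cite: Lang2002, VI §1 Thm. 1.1, Cor. 1.6 and V §2 Thm. 2.8] [cite: DixonMortimer1996, §1.6] -/
theorem exists_ringEquiv_fix_comp_eq_of_injective_of_finrank (M : IntermediateField ℚ ℂ) [FiniteDimensional ℚ M] (hτM : ∀ x, τ x ∈ M)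
    (s : J → (K →+* ℂ)) (hsi : Function.Injective s) (hs : ∀ j, (s j).comp i = τ) (n : ℕ)
    (hn : (Finset.univ.filter fun u : K →+* ℂ => u.comp i = τ).card = n)
    (hdeg : Module.finrank ℚ ↥(M ⊔ adjoin ℚ (⋃ j, Set.range (s j))) = Module.finrank ℚ M * n.descFactorial (Fintype.card J))
    (s' : J → (K →+* ℂ)) (hsi' : Function.Injective s') (hs' : ∀ j, (s' j).comp i = τ) :
    ∃ ρ : ℂ ≃+* ℂ, (∀ x ∈ M, ρ x = x) ∧ ∀ j, (ρ : ℂ →+* ℂ).comp (s j) = s' j := by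
  classical
  set S : Set ℂ := ⋃ j, Set.range (s j) with hS
  -- the target count is positive (an injective family exists), so `F = M(S)` has finite degree
  have hpos : 0 < Module.finrank ℚ M * n.descFactorial (Fintype.card J) := by
    refine Nat.mul_pos Module.finrank_pos ?_
    rw [← card_injective_families_over i τ n hn]
    exact Fintype.card_pos_iff.2 ⟨⟨s, hsi, hs⟩⟩
  have hres : (adjoin M S).restrictScalars ℚ = M ⊔ adjoin ℚ S := restrictScalars_adjoin_eq_sup ℚ M S
  have hdegQ : Module.finrank ℚ ↥((adjoin M S).restrictScalars ℚ) = Module.finrank ℚ M * n.descFactorial (Fintype.card J) := by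
    rw [hres, hdeg]
  haveI hfinQ : FiniteDimensional ℚ ↥(adjoin M S) := by
    have h : FiniteDimensional ℚ ↥((adjoin M S).restrictScalars ℚ) := Module.finite_of_finrank_pos (by rw [hdegQ]; exact hpos)
    exact h
  haveI : FiniteDimensional M ↥(adjoin M S) := Module.Finite.of_restrictScalars_finite ℚ M _
  have hdegM : Module.finrank M ↥(adjoin M S) = n.descFactorial (Fintype.card J) := by
    have h := Module.finrank_mul_finrank ℚ M ↥(adjoin M S)
    have h' : Module.finrank ℚ ↥(adjoin M S) = Module.finrank ℚ M * n.descFactorial (Fintype.card J) := hdegQ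
    rw [h'] at h
    exact Nat.eq_of_mul_eq_mul_left Module.finrank_pos h
  have hmemF : ∀ j (a : K), s j a ∈ adjoin M S := fun j a => subset_adjoin M S (Set.mem_iUnion.2 ⟨j, a, rfl⟩)
  -- restriction of an `M`-embedding of `F` to the family; it stays injective
  let Φ : (↥(adjoin M S) →ₐ[M] ℂ) → {u : J → (K →+* ℂ) // Function.Injective u ∧ ∀ j, (u j).comp i = τ} := fun φ =>
    ⟨fun j => φ.toRingHom.comp ((s j).codRestrict (adjoin M S) (hmemF j)), fun j j' hjj' => by
      apply hsi
      ext a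
      have h := RingHom.congr_fun hjj' a
      exact congrArg Subtype.val (φ.toRingHom.injective h), fun j => by
      ext x
      have h1 : s j (i x) = τ x := RingHom.congr_fun (hs j) x
      have h2 : (⟨s j (i x), hmemF j _⟩ : ↥(adjoin M S)) = algebraMap M ↥(adjoin M S) ⟨τ x, hτM x⟩ := Subtype.ext h1
      show φ ⟨s j (i x), hmemF j _⟩ = τ x
      rw [h2, AlgHom.commutes]
      rfl⟩
  have hΦapp : ∀ φ j (a : K), ((Φ φ).1 j) a = φ ⟨s j a, hmemF j a⟩ := fun φ j a => rfl
  have hΦ : Function.Injective Φ := by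
    intro φ ψ h
    apply algHom_adjoin_ext M
    intro x hx
    obtain ⟨j, a, rfl⟩ := Set.mem_iUnion.1 hx
    rw [← hΦapp φ j a, ← hΦapp ψ j a, h]
  have hcard : Fintype.card (↥(adjoin M S) →ₐ[M] ℂ) =
      Fintype.card {u : J → (K →+* ℂ) // Function.Injective u ∧ ∀ j, (u j).comp i = τ} := by
    rw [AlgHom.card M ↥(adjoin M S) ℂ, hdegM, card_injective_families_over i τ n hn]
  obtain ⟨φ, hφ⟩ := ((Fintype.bijective_iff_injective_and_card Φ).2 ⟨hΦ, hcard⟩).2 ⟨s', hsi', hs'⟩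
  obtain ⟨ρ, hρM, hρ⟩ := exists_ringEquiv_extends_algHom_adjoin M φ
  refine ⟨ρ, hρM, fun j => RingHom.ext fun a => ?_⟩
  rw [RingHom.coe_comp, Function.comp_apply, RingHom.coe_coe, hρ (s j a) (hmemF j a), ← hΦapp φ j a, hφ]

/-- `n (n−1) ⋯` with two factors: `n.descFactorial 2 = n (n−1)`. [folklore] -/
theorem descFactorial_two (n : ℕ) : n.descFactorial 2 = n * (n - 1) := by
  rw [Nat.descFactorial_succ, Nat.descFactorial_one, mul_comm]

variable {i τ} in
/-- **RELATIVE `2`-TRANSITIVITY from ONE degree `n(n−1)`** (the hypothesis `h2T` of the `2`-transitive ∕ mixed towers).  `M ⊂ ℂ` of finite degree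
containing `τ(k)`, `n` the number of embeddings of `K` over `τ`; if for ONE pair `s₀ ≠ t₀` of embeddings over `τ` the subfield
`M ⊔ ℚ(s₀(K) ∪ t₀(K))` has degree `[M : ℚ] · n(n−1)` — i.e. `[M·s₀(K)·t₀(K) : M] = n(n−1)` — then ANY two pairs `s ≠ t`, `s' ≠ t'` of embeddings
over `τ` are interchanged by an automorphism of `ℂ` fixing `M` pointwise: `ρ ∘ s = s'`, `ρ ∘ t = t'`.
[cite: Lang2002, VI §1 Thm. 1.1, Cor. 1.6 and V §2 Thm. 2.8] [cite: DixonMortimer1996, §1.6] -/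
theorem exists_ringEquiv_fix_pair_of_finrank (M : IntermediateField ℚ ℂ) [FiniteDimensional ℚ M] (hτM : ∀ x, τ x ∈ M)
    {s₀ t₀ : K →+* ℂ} (hs₀ : s₀.comp i = τ) (ht₀ : t₀.comp i = τ) (hst₀ : s₀ ≠ t₀) (n : ℕ)
    (hn : (Finset.univ.filter fun u : K →+* ℂ => u.comp i = τ).card = n)
    (hdeg : Module.finrank ℚ ↥(M ⊔ adjoin ℚ (Set.range s₀ ∪ Set.range t₀)) = Module.finrank ℚ M * (n * (n - 1)))
    (s t s' t' : K →+* ℂ) (hs : s.comp i = τ) (ht : t.comp i = τ) (hs' : s'.comp i = τ) (ht' : t'.comp i = τ)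
    (hst : s ≠ t) (hst' : s' ≠ t') :
    ∃ ρ : ℂ ≃+* ℂ, (∀ x ∈ M, ρ x = x) ∧ (ρ : ℂ →+* ℂ).comp s = s' ∧ (ρ : ℂ →+* ℂ).comp t = t' := by
  classical
  -- the reference pair as an injective `Fin 2`-family
  have hU : (⋃ j : Fin 2, Set.range (![s₀, t₀] j)) = Set.range s₀ ∪ Set.range t₀ := by
    ext x
    simp only [Set.mem_iUnion, Set.mem_union, Fin.exists_fin_two, Matrix.cons_val_zero, Matrix.cons_val_one]
  have hinj : ∀ {a b : K →+* ℂ}, a ≠ b → Function.Injective ![a, b] := by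
    intro a b hab j j' h
    fin_cases j <;> fin_cases j'
    · rfl
    · exact absurd h hab
    · exact absurd h.symm hab
    · rfl
  have hover : ∀ {a b : K →+* ℂ}, a.comp i = τ → b.comp i = τ → ∀ j : Fin 2, (![a, b] j).comp i = τ := by
    intro a b ha hb j
    fin_cases j
    · exact ha
    · exact hb
  have hdeg' : Module.finrank ℚ ↥(M ⊔ adjoin ℚ (⋃ j : Fin 2, Set.range (![s₀, t₀] j))) =
      Module.finrank ℚ M * n.descFactorial (Fintype.card (Fin 2)) := by
    rw [hU, hdeg, Fintype.card_fin, descFactorial_two]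
  have key : ∀ {a b : K →+* ℂ}, a.comp i = τ → b.comp i = τ → a ≠ b →
      ∃ ρ : ℂ ≃+* ℂ, (∀ x ∈ M, ρ x = x) ∧ (ρ : ℂ →+* ℂ).comp s₀ = a ∧ (ρ : ℂ →+* ℂ).comp t₀ = b := by
    intro a b ha hb hab
    obtain ⟨ρ, hρM, hρ⟩ := exists_ringEquiv_fix_comp_eq_of_injective_of_finrank M hτM ![s₀, t₀] (hinj hst₀) (hover hs₀ ht₀) n hn hdeg'
      ![a, b] (hinj hab) (hover ha hb)
    exact ⟨ρ, hρM, hρ 0, hρ 1⟩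
  obtain ⟨ρ₁, hρ₁M, hρ₁s, hρ₁t⟩ := key hs ht hst
  obtain ⟨ρ₂, hρ₂M, hρ₂s, hρ₂t⟩ := key hs' ht' hst'
  refine ⟨ρ₁.symm.trans ρ₂, fun x hx => ?_, ?_, ?_⟩
  · have h1 : ρ₁.symm x = x := by
      rw [RingEquiv.symm_apply_eq]
      exact (hρ₁M x hx).symm
    show ρ₂ (ρ₁.symm x) = x
    rw [h1, hρ₂M x hx]
  · ext a
    have h1 : ρ₁.symm (s a) = s₀ a := by
      rw [RingEquiv.symm_apply_eq]
      exact (RingHom.congr_fun hρ₁s a).symm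
    show ρ₂ (ρ₁.symm (s a)) = s' a
    rw [h1]
    exact RingHom.congr_fun hρ₂s a
  · ext a
    have h1 : ρ₁.symm (t a) = t₀ a := by
      rw [RingEquiv.symm_apply_eq]
      exact (RingHom.congr_fun hρ₁t a).symm
    show ρ₂ (ρ₁.symm (t a)) = t' a
    rw [h1]
    exact RingHom.congr_fun hρ₂t a

end Injective

end Summit.HodgeConjecture.CorCM.MultiFieldWeil

end
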